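import Mathlib
import HarnessLib

/-!
# Mapping a semi-infinite interval onto a finite one: the substitutions of Davis–Rabinowitz, Sect. 3.1

**Statement.** The changes of variable of P. J. Davis, P. Rabinowitz, *Methods of Numerical Integration* (2nd ed.,
1984), Chapter 3 "Approximate Integration over Infinite Intervals", Sect. 3.1 "Change of Variable", that carry
`∫_a^∞ f` (or `∫_0^∞ f`) to an integral over `[0, 1]` or `[-1, 1]` — stated as identities that hold for EVERY
`f : ℝ → ℝ` (no continuity, decay or integrability hypothesis: both sides are Lebesgue integrals, and
integrability transfers along an injective `C¹` substitution, `MeasureTheory.integral_image_eq_integral_abs_deriv_smul`;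
when one side diverges both are the junk value `0`):

* `x = e^{-y}` (3.1.1): `∫ y in Ioi 0, f y = ∫ x in 0..1, f (-log x) / x` (`integral_Ioi_substitution_neg_log`), and its
  companion (3.1.2) `∫ y in Ioi 0, e^{-y} f y = ∫ x in 0..1, f (-log x)` (`integral_Ioi_exp_neg_mul_substitution_neg_log`);
* `t = x/(1+x)`, i.e. `x = t/(1-t)` (the instance of (3.1.3) named in the text):
  `∫ x in Ioi 0, f x = ∫ t in 0..1, f (t/(1-t)) / (1-t)²` (`integral_Ioi_substitution_div_one_sub`);
* de Doncker–Piessens (3.1.4), `x = a + (1+t)/(1-t)`: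
  `∫ x in Ioi a, f x = ∫ t in -1..1, f (a + (1+t)/(1-t)) · 2/(1-t)²` (`integral_Ioi_substitution_one_add_div_one_sub`);
* Piessens et al. (QUADPACK's map for infinite ranges) (3.1.5), `x = a + (1-t)/t`:
  `∫ x in Ioi a, f x = ∫ t in 0..1, f (a + (1-t)/t) / t²` (`integral_Ioi_substitution_one_sub_div`), with the matching
  integrability transfer `integrableOn_Ioi_iff_one_sub_div`;
* Squire's split (3.1.9), `t = x/S` on `[0, S]` and `t = S/x` on `[S, ∞)`: for `f` integrable on `(0, ∞)` and `S > 0`,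
  `∫ x in Ioi 0, f x = S · ∫ t in 0..1, (f (S t) + f (S/t) / t²)` (`integral_Ioi_eq_squire_split`; here integrability IS
  needed — the right-hand side adds two integrands — and the hypothesis-free half `∫ x in Ioi S, f x =
  ∫ t in 0..1, S / t² · f (S/t)` is `integral_Ioi_substitution_div`).

**Why here.** These maps are how a rule — or a certified enclosure — for `[0, 1]` is turned into one for a half line
((3.1.5) is the transformation inside QUADPACK's `QAGI`); read right to left they let a BOX certificate on `[0, 1]`
certify `∫_a^∞ f`. Prior art in the tree (NOT restated): the whole-line substitution `x = tan t` (3.1.6) is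
`Literature.Analysis.SpecialFunctions.integral_comp_tan` (hypothesis-free, with `integrable_iff_comp_tan`), and the
whole-axis maps of Sect. 3.4.5 (`x = eᵘ`, sinh, tanh, DE) are `Literature.MeasureTheory.Integral.WholeAxisSubstitution` /
`Literature.Analysis.Quadrature.TanhSinhTransformation`. The periodicity identities (3.1.7)–(3.1.8) are not formalised.

**Engine.** Mathlib: `MeasureTheory.integral_image_eq_integral_abs_deriv_smul`,
`MeasureTheory.integrableOn_image_iff_integrableOn_abs_deriv_smul`, `Real.log_injOn_pos`,
`intervalIntegral.smul_integral_comp_mul_left`, `MeasureTheory.setIntegral_union`.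

References: P. J. Davis, P. Rabinowitz, Methods of Numerical Integration, 2nd ed., Academic Press 1984, Sect. 3.1,
(3.1.1)–(3.1.5), (3.1.9) (bib key `DavisRabinowitz1984`); R. Piessens, E. de Doncker-Kapenga, C. W. Überhuber,
D. K. Kahaner, QUADPACK, Springer 1983 (the map (3.1.5)). Standard axioms only.
-/

open _root_.MeasureTheory Set intervalIntegral Real
open scoped Interval

noncomputable section

namespace Literature.MeasureTheory.Integral

/-! ### Images of the substitutions -/

/-- `x ↦ -log x` maps `(0, 1)` onto `(0, ∞)`. [cite: DavisRabinowitz1984, Sect. 3.1 (3.1.1)] -/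
theorem image_neg_log_Ioo_zero_one : (fun x => -log x) '' Ioo (0:ℝ) 1 = Ioi 0 := by
  ext y
  simp only [mem_image, mem_Ioo, mem_Ioi]
  constructor
  · rintro ⟨x, ⟨hx0, hx1⟩, rfl⟩
    have := log_neg hx0 hx1
    linarith
  · intro hy
    exact ⟨exp (-y), ⟨exp_pos _, by rw [← exp_zero]; exact exp_lt_exp.mpr (by linarith)⟩, by rw [log_exp, neg_neg]⟩

/-- `t ↦ t/(1-t)` maps `(0, 1)` onto `(0, ∞)`. [cite: DavisRabinowitz1984, Sect. 3.1 (3.1.3)] -/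
theorem image_div_one_sub_Ioo_zero_one : (fun t => t / (1 - t)) '' Ioo (0:ℝ) 1 = Ioi 0 := by
  ext x
  simp only [mem_image, mem_Ioo, mem_Ioi]
  constructor
  · rintro ⟨t, ⟨ht0, ht1⟩, rfl⟩
    exact div_pos ht0 (by linarith)
  · intro hx
    refine ⟨x / (1 + x), ⟨by positivity, by rw [div_lt_one (by linarith)]; linarith⟩, ?_⟩
    field_simp
    ring

/-- `t ↦ a + (1+t)/(1-t)` maps `(-1, 1)` onto `(a, ∞)`. [cite: DavisRabinowitz1984, Sect. 3.1 (3.1.4)] -/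
theorem image_one_add_div_one_sub_Ioo (a : ℝ) :
    (fun t => a + (1 + t) / (1 - t)) '' Ioo (-1:ℝ) 1 = Ioi a := by
  ext x
  simp only [mem_image, mem_Ioo, mem_Ioi]
  constructor
  · rintro ⟨t, ⟨ht0, ht1⟩, rfl⟩
    have : 0 < (1 + t) / (1 - t) := div_pos (by linarith) (by linarith)
    linarith
  · intro hx
    have hx' : 0 < x - a := by linarith
    refine ⟨(x - a - 1) / (x - a + 1), ⟨?_, ?_⟩, ?_⟩
    · rw [lt_div_iff₀ (by linarith)]; linarith
    · rw [div_lt_one (by linarith)]; linarith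
    · have h1 : x - a + 1 ≠ 0 := by positivity
      field_simp
      ring

/-- `t ↦ a + (1-t)/t` maps `(0, 1)` onto `(a, ∞)`. [cite: DavisRabinowitz1984, Sect. 3.1 (3.1.5)] -/
theorem image_one_sub_div_Ioo (a : ℝ) : (fun t => a + (1 - t) / t) '' Ioo (0:ℝ) 1 = Ioi a := by
  ext x
  simp only [mem_image, mem_Ioo, mem_Ioi]
  constructor
  · rintro ⟨t, ⟨ht0, ht1⟩, rfl⟩
    have : 0 < (1 - t) / t := div_pos (by linarith) ht0
    linarith
  · intro hx
    refine ⟨1 / (1 + (x - a)), ⟨by positivity, by rw [div_lt_one (by linarith)]; linarith⟩, ?_⟩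
    have h1 : 1 + (x - a) ≠ 0 := by positivity
    field_simp
    ring

/-- `t ↦ S/t` (`S > 0`) maps `(0, 1)` onto `(S, ∞)`. [cite: DavisRabinowitz1984, Sect. 3.1 (3.1.9)] -/
theorem image_div_Ioo_zero_one {S : ℝ} (hS : 0 < S) : (fun t => S / t) '' Ioo (0:ℝ) 1 = Ioi S := by
  ext x
  simp only [mem_image, mem_Ioo, mem_Ioi]
  constructor
  · rintro ⟨t, ⟨ht0, ht1⟩, rfl⟩
    rw [lt_div_iff₀ ht0]
    nlinarith
  · intro hx
    have hx0 : 0 < x := hS.trans hx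
    refine ⟨S / x, ⟨by positivity, by rw [div_lt_one hx0]; exact hx⟩, ?_⟩
    field_simp

/-! ### The substitutions (3.1.1)–(3.1.5) -/

/-- **`x = e^{-y}`** (3.1.1): for every `f`, `∫ y in Ioi 0, f y = ∫ x in 0..1, f (-log x) / x`.
[cite: DavisRabinowitz1984, Sect. 3.1 (3.1.1)] -/
theorem integral_Ioi_substitution_neg_log (f : ℝ → ℝ) :
    ∫ y in Ioi 0, f y = ∫ x in (0:ℝ)..1, f (-log x) / x := by
  have h := integral_image_eq_integral_abs_deriv_smul (s := Ioo (0:ℝ) 1) (f := fun x => -log x)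
    (f' := fun x => -x⁻¹) measurableSet_Ioo
    (fun x hx => ((hasDerivAt_log hx.1.ne').neg).hasDerivWithinAt)
    (fun x hx y hy hxy => log_injOn_pos hx.1 hy.1 (neg_injective hxy)) f
  rw [image_neg_log_Ioo_zero_one] at h
  rw [intervalIntegral.integral_of_le zero_le_one, integral_Ioc_eq_integral_Ioo, h]
  refine setIntegral_congr_fun measurableSet_Ioo fun x hx => ?_
  rw [abs_neg, abs_of_pos (inv_pos.mpr hx.1), smul_eq_mul, inv_mul_eq_div]

/-- **`x = e^{-y}`, weighted form** (3.1.2): for every `f`, `∫ y in Ioi 0, e^{-y} f y = ∫ x in 0..1, f (-log x)`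
(the text writes `f (log (1/x))`). [cite: DavisRabinowitz1984, Sect. 3.1 (3.1.2)] -/
theorem integral_Ioi_exp_neg_mul_substitution_neg_log (f : ℝ → ℝ) :
    ∫ y in Ioi 0, exp (-y) * f y = ∫ x in (0:ℝ)..1, f (-log x) := by
  rw [integral_Ioi_substitution_neg_log (fun y => exp (-y) * f y), intervalIntegral.integral_of_le zero_le_one,
    intervalIntegral.integral_of_le zero_le_one, integral_Ioc_eq_integral_Ioo, integral_Ioc_eq_integral_Ioo]
  refine setIntegral_congr_fun measurableSet_Ioo fun x hx => ?_
  rw [neg_neg, exp_log hx.1]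
  field_simp [hx.1.ne']

/-- **`x = t/(1-t)`** (`t = x/(1+x)`, (3.1.3)): for every `f`, `∫ x in Ioi 0, f x = ∫ t in 0..1, f (t/(1-t)) / (1-t)²`.
[cite: DavisRabinowitz1984, Sect. 3.1 (3.1.3)] -/
theorem integral_Ioi_substitution_div_one_sub (f : ℝ → ℝ) :
    ∫ x in Ioi 0, f x = ∫ t in (0:ℝ)..1, f (t / (1 - t)) / (1 - t) ^ 2 := by
  have hder : ∀ t ∈ Ioo (0:ℝ) 1, HasDerivWithinAt (fun t : ℝ => t / (1 - t)) (1 / (1 - t) ^ 2) (Ioo (0:ℝ) 1) t := by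
    intro t ht
    have h1 : (1 - t) ≠ 0 := by linarith [ht.2]
    have h := (hasDerivAt_id t).div ((hasDerivAt_const t (1:ℝ)).sub (hasDerivAt_id t)) h1
    refine (h.congr_deriv ?_).hasDerivWithinAt
    simp only [id, Pi.sub_apply]
    ring
  have hinj : (Ioo (0:ℝ) 1).InjOn (fun t : ℝ => t / (1 - t)) := by
    intro t ht s hs hts
    have h1 : (1 - t) ≠ 0 := by linarith [ht.2]
    have h2 : (1 - s) ≠ 0 := by linarith [hs.2]
    rw [div_eq_div_iff h1 h2] at hts
    linarith
  have h := integral_image_eq_integral_abs_deriv_smul (s := Ioo (0:ℝ) 1) (f := fun t : ℝ => t / (1 - t))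
    (f' := fun t => 1 / (1 - t) ^ 2) measurableSet_Ioo hder hinj f
  rw [image_div_one_sub_Ioo_zero_one] at h
  rw [intervalIntegral.integral_of_le zero_le_one, integral_Ioc_eq_integral_Ioo, h]
  refine setIntegral_congr_fun measurableSet_Ioo fun t ht => ?_
  have h1 : 0 < (1 - t) ^ 2 := by have := ht.2; positivity
  rw [abs_of_pos (by positivity), smul_eq_mul, one_div, inv_mul_eq_div]

/-- **de Doncker–Piessens** (3.1.4), `x = a + (1+t)/(1-t)`: for every `f` and `a`,
`∫ x in Ioi a, f x = ∫ t in -1..1, f (a + (1+t)/(1-t)) · 2/(1-t)²`. [cite: DavisRabinowitz1984, Sect. 3.1 (3.1.4)] -/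
theorem integral_Ioi_substitution_one_add_div_one_sub (a : ℝ) (f : ℝ → ℝ) :
    ∫ x in Ioi a, f x = ∫ t in (-1:ℝ)..1, f (a + (1 + t) / (1 - t)) * (2 / (1 - t) ^ 2) := by
  have hder : ∀ t ∈ Ioo (-1:ℝ) 1,
      HasDerivWithinAt (fun t : ℝ => a + (1 + t) / (1 - t)) (2 / (1 - t) ^ 2) (Ioo (-1:ℝ) 1) t := by
    intro t ht
    have h1 : (1 - t) ≠ 0 := by linarith [ht.2]
    have h := (((hasDerivAt_const t (1:ℝ)).add (hasDerivAt_id t)).div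
      ((hasDerivAt_const t (1:ℝ)).sub (hasDerivAt_id t)) h1).const_add a
    refine (h.congr_deriv ?_).hasDerivWithinAt
    simp only [id, Pi.sub_apply, Pi.add_apply]
    ring
  have hinj : (Ioo (-1:ℝ) 1).InjOn (fun t : ℝ => a + (1 + t) / (1 - t)) := by
    intro t ht s hs hts
    have h1 : (1 - t) ≠ 0 := by linarith [ht.2]
    have h2 : (1 - s) ≠ 0 := by linarith [hs.2]
    have hts' : (1 + t) / (1 - t) = (1 + s) / (1 - s) := add_left_cancel hts
    rw [div_eq_div_iff h1 h2] at hts'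
    linarith
  have h := integral_image_eq_integral_abs_deriv_smul (s := Ioo (-1:ℝ) 1) (f := fun t : ℝ => a + (1 + t) / (1 - t))
    (f' := fun t => 2 / (1 - t) ^ 2) measurableSet_Ioo hder hinj f
  rw [image_one_add_div_one_sub_Ioo] at h
  rw [intervalIntegral.integral_of_le (by norm_num), integral_Ioc_eq_integral_Ioo, h]
  refine setIntegral_congr_fun measurableSet_Ioo fun t ht => ?_
  have h1 : 0 < (1 - t) ^ 2 := by have := ht.2; positivity
  rw [abs_of_pos (by positivity), smul_eq_mul, mul_comm]

/-- **Piessens et al. / QUADPACK** (3.1.5), `x = a + (1-t)/t`: for every `f` and `a`,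
`∫ x in Ioi a, f x = ∫ t in 0..1, f (a + (1-t)/t) / t²`. [cite: DavisRabinowitz1984, Sect. 3.1 (3.1.5)] -/
theorem integral_Ioi_substitution_one_sub_div (a : ℝ) (f : ℝ → ℝ) :
    ∫ x in Ioi a, f x = ∫ t in (0:ℝ)..1, f (a + (1 - t) / t) / t ^ 2 := by
  have hder : ∀ t ∈ Ioo (0:ℝ) 1,
      HasDerivWithinAt (fun t : ℝ => a + (1 - t) / t) (-1 / t ^ 2) (Ioo (0:ℝ) 1) t := by
    intro t ht
    have h1 : t ≠ 0 := ht.1.ne'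
    have h := ((((hasDerivAt_const t (1:ℝ)).sub (hasDerivAt_id t)).div (hasDerivAt_id t) h1)).const_add a
    refine (h.congr_deriv ?_).hasDerivWithinAt
    simp only [id, Pi.sub_apply]
    ring
  have hinj : (Ioo (0:ℝ) 1).InjOn (fun t : ℝ => a + (1 - t) / t) := by
    intro t ht s hs hts
    have hts' : (1 - t) / t = (1 - s) / s := add_left_cancel hts
    rw [div_eq_div_iff ht.1.ne' hs.1.ne'] at hts'
    linarith
  have h := integral_image_eq_integral_abs_deriv_smul (s := Ioo (0:ℝ) 1) (f := fun t : ℝ => a + (1 - t) / t)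
    (f' := fun t => -1 / t ^ 2) measurableSet_Ioo hder hinj f
  rw [image_one_sub_div_Ioo] at h
  rw [intervalIntegral.integral_of_le zero_le_one, integral_Ioc_eq_integral_Ioo, h]
  refine setIntegral_congr_fun measurableSet_Ioo fun t ht => ?_
  have h1 : 0 < t ^ 2 := by have := ht.1; positivity
  rw [neg_div, abs_neg, abs_of_pos (by positivity), smul_eq_mul, one_div, inv_mul_eq_div]

/-- Integrability transfers along (3.1.5): `f` is integrable on `(a, ∞)` iff `t ↦ f (a + (1-t)/t) / t²` is
interval-integrable on `[0, 1]`. [cite: DavisRabinowitz1984, Sect. 3.1 (3.1.5)] -/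
theorem integrableOn_Ioi_iff_one_sub_div (a : ℝ) (f : ℝ → ℝ) :
    IntegrableOn f (Ioi a) ↔ IntervalIntegrable (fun t => f (a + (1 - t) / t) / t ^ 2) volume 0 1 := by
  have hder : ∀ t ∈ Ioo (0:ℝ) 1,
      HasDerivWithinAt (fun t : ℝ => a + (1 - t) / t) (-1 / t ^ 2) (Ioo (0:ℝ) 1) t := by
    intro t ht
    have h1 : t ≠ 0 := ht.1.ne'
    have h := ((((hasDerivAt_const t (1:ℝ)).sub (hasDerivAt_id t)).div (hasDerivAt_id t) h1)).const_add a
    refine (h.congr_deriv ?_).hasDerivWithinAt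
    simp only [id, Pi.sub_apply]
    ring
  have hinj : (Ioo (0:ℝ) 1).InjOn (fun t : ℝ => a + (1 - t) / t) := by
    intro t ht s hs hts
    have hts' : (1 - t) / t = (1 - s) / s := add_left_cancel hts
    rw [div_eq_div_iff ht.1.ne' hs.1.ne'] at hts'
    linarith
  have h := integrableOn_image_iff_integrableOn_abs_deriv_smul (s := Ioo (0:ℝ) 1)
    (f := fun t : ℝ => a + (1 - t) / t) (f' := fun t => -1 / t ^ 2) measurableSet_Ioo hder hinj f
  rw [image_one_sub_div_Ioo] at h
  rw [h, intervalIntegrable_iff_integrableOn_Ioo_of_le zero_le_one]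
  refine integrableOn_congr_fun (fun t ht => ?_) measurableSet_Ioo
  have h1 : 0 < t ^ 2 := by have := ht.1; positivity
  rw [neg_div, abs_neg, abs_of_pos (by positivity), smul_eq_mul, one_div, inv_mul_eq_div]

/-! ### Squire's split (3.1.9) -/

/-- The second half of Squire's split, hypothesis-free: `x = S/t` gives `∫ x in Ioi S, f x = ∫ t in 0..1, S/t² · f (S/t)`
(`S > 0`). [cite: DavisRabinowitz1984, Sect. 3.1 (3.1.9)] -/
theorem integral_Ioi_substitution_div {S : ℝ} (hS : 0 < S) (f : ℝ → ℝ) :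
    ∫ x in Ioi S, f x = ∫ t in (0:ℝ)..1, S / t ^ 2 * f (S / t) := by
  have hder : ∀ t ∈ Ioo (0:ℝ) 1, HasDerivWithinAt (fun t : ℝ => S / t) (-S / t ^ 2) (Ioo (0:ℝ) 1) t := by
    intro t ht
    have h1 : t ≠ 0 := ht.1.ne'
    have h := (hasDerivAt_const t S).div (hasDerivAt_id t) h1
    refine (h.congr_deriv ?_).hasDerivWithinAt
    simp only [id]
    ring
  have hinj : (Ioo (0:ℝ) 1).InjOn (fun t : ℝ => S / t) := by
    intro t ht s hs hts
    rw [div_eq_div_iff ht.1.ne' hs.1.ne'] at hts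
    nlinarith [ht.1, hs.1]
  have h := integral_image_eq_integral_abs_deriv_smul (s := Ioo (0:ℝ) 1) (f := fun t : ℝ => S / t)
    (f' := fun t => -S / t ^ 2) measurableSet_Ioo hder hinj f
  rw [image_div_Ioo_zero_one hS] at h
  rw [intervalIntegral.integral_of_le zero_le_one, integral_Ioc_eq_integral_Ioo, h]
  refine setIntegral_congr_fun measurableSet_Ioo fun t ht => ?_
  have h1 : 0 < S / t ^ 2 := by have := ht.1; positivity
  rw [neg_div, abs_neg, abs_of_pos h1, smul_eq_mul]

/-- Integrability transfers along `x = S/t`: `f` is integrable on `(S, ∞)` iff `t ↦ S/t² · f (S/t)` is interval-integrable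
on `[0, 1]` (`S > 0`). [cite: DavisRabinowitz1984, Sect. 3.1 (3.1.9)] -/
theorem integrableOn_Ioi_iff_div {S : ℝ} (hS : 0 < S) (f : ℝ → ℝ) :
    IntegrableOn f (Ioi S) ↔ IntervalIntegrable (fun t => S / t ^ 2 * f (S / t)) volume 0 1 := by
  have hder : ∀ t ∈ Ioo (0:ℝ) 1, HasDerivWithinAt (fun t : ℝ => S / t) (-S / t ^ 2) (Ioo (0:ℝ) 1) t := by
    intro t ht
    have h1 : t ≠ 0 := ht.1.ne'
    have h := (hasDerivAt_const t S).div (hasDerivAt_id t) h1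
    refine (h.congr_deriv ?_).hasDerivWithinAt
    simp only [id]
    ring
  have hinj : (Ioo (0:ℝ) 1).InjOn (fun t : ℝ => S / t) := by
    intro t ht s hs hts
    rw [div_eq_div_iff ht.1.ne' hs.1.ne'] at hts
    nlinarith [ht.1, hs.1]
  have h := integrableOn_image_iff_integrableOn_abs_deriv_smul (s := Ioo (0:ℝ) 1) (f := fun t : ℝ => S / t)
    (f' := fun t => -S / t ^ 2) measurableSet_Ioo hder hinj f
  rw [image_div_Ioo_zero_one hS] at h
  rw [h, intervalIntegrable_iff_integrableOn_Ioo_of_le zero_le_one]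
  refine integrableOn_congr_fun (fun t ht => ?_) measurableSet_Ioo
  have h1 : 0 < S / t ^ 2 := by have := ht.1; positivity
  rw [neg_div, abs_neg, abs_of_pos h1, smul_eq_mul]

/-- **Squire's split** (3.1.9): for `f` integrable on `(0, ∞)` and `S > 0`,
`∫ x in Ioi 0, f x = S · ∫ t in 0..1, (f (S t) + f (S/t) / t²)` — `t = x/S` on `[0, S]`, `t = S/x` on `[S, ∞)`;
any rule for `[0, 1]` thereby becomes a rule (3.1.10) for `[0, ∞)`. [cite: DavisRabinowitz1984, Sect. 3.1 (3.1.9)] -/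
theorem integral_Ioi_eq_squire_split {S : ℝ} (hS : 0 < S) {f : ℝ → ℝ} (hf : IntegrableOn f (Ioi 0)) :
    ∫ x in Ioi 0, f x = S * ∫ t in (0:ℝ)..1, (f (S * t) + f (S / t) / t ^ 2) := by
  -- split `(0, ∞) = (0, S] ∪ (S, ∞)`
  have hsplit : ∫ x in Ioi 0, f x = (∫ x in (0:ℝ)..S, f x) + ∫ x in Ioi S, f x := by
    rw [← Ioc_union_Ioi_eq_Ioi hS.le, setIntegral_union Ioc_disjoint_Ioi_same measurableSet_Ioi
      (hf.mono_set Ioc_subset_Ioi_self) (hf.mono_set (Ioi_subset_Ioi hS.le)),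
      intervalIntegral.integral_of_le hS.le]
  -- first piece: `t = x/S`
  have h1 : ∫ x in (0:ℝ)..S, f x = S * ∫ t in (0:ℝ)..1, f (S * t) := by
    have := intervalIntegral.smul_integral_comp_mul_left (f := f) (a := 0) (b := 1) S
    rw [mul_zero, mul_one] at this
    rw [← this, smul_eq_mul]
  -- second piece: `t = S/x`
  have h2 : ∫ x in Ioi S, f x = S * ∫ t in (0:ℝ)..1, f (S / t) / t ^ 2 := by
    rw [integral_Ioi_substitution_div hS, ← intervalIntegral.integral_const_mul]
    refine intervalIntegral.integral_congr fun t _ => ?_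
    ring
  -- integrability of the two transformed integrands on `[0, 1]`
  have hi1 : IntervalIntegrable (fun t => f (S * t)) volume 0 1 := by
    have hf0S : IntervalIntegrable f volume 0 S :=
      (intervalIntegrable_iff_integrableOn_Ioc_of_le hS.le).mpr (hf.mono_set Ioc_subset_Ioi_self)
    have := hf0S.comp_mul_left (c := S)
    rwa [zero_div, div_self hS.ne'] at this
  have hi2 : IntervalIntegrable (fun t => f (S / t) / t ^ 2) volume 0 1 := by
    have h := (integrableOn_Ioi_iff_div hS f).mp (hf.mono_set (Ioi_subset_Ioi hS.le))
    rw [intervalIntegrable_iff_integrableOn_Ioo_of_le zero_le_one] at h ⊢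
    have h' : IntegrableOn (fun t => S⁻¹ * (S / t ^ 2 * f (S / t))) (Ioo (0:ℝ) 1) := h.const_mul S⁻¹
    refine h'.congr_fun (fun t ht => ?_) measurableSet_Ioo
    have ht0 : t ≠ 0 := ht.1.ne'
    field_simp
  rw [hsplit, h1, h2, ← mul_add, ← intervalIntegral.integral_add hi1 hi2]

end Literature.MeasureTheory.Integral

end
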